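import Mathlib
import HarnessLib
import Literature.MathematicalPhysics.QuantumLattice.HubbardSectorPropagatorGram
import Literature.MathematicalPhysics.QuantumLattice.HubbardSectorFieldSubstitution

/-!
# Route `KLProgramme` — ENGINE child gen 8 (stmt-HubbardSuperconductivity-20437 `KLRegimeEngineV17F2`), SKELETON v2 class #3, PROVING side:
# POINT AUGMENTATION of a thin/fat sector pair — families and invariance of pulled-back lines / Gram data (FINDING (E5-LABELS), cure (α))
# (cell gate-hubbard-kl, seat p5 g7; generic companion of `…EngineV8E5Block` (p544244); consumed by `…EngineV8E5BlockLabels`)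

(E5-LABELS) (KL STATUS 2026-08-27T15:46Z): `E5ShareStep` (p541670) bounds `klE5Block` at ALL pair labels of the UV ball, while the sector route of
`norm_klE5Block_le_of_tails` needs the plateau `{Σ_ω F_ω = 1}` to contain the four external momenta (`block(S_R W) = (∏ R(X′_i))·block(W)`).
Cure (α), no text change: AUGMENT `(F, F̃)` by POINT multipliers at `q` given momenta `e`; everything the bridge reads about the LINES is unchanged:
* §1 `pointAugment F e` = `F` then `P_j(k) = [k = e_j]·(1 − Σ_ωF_ω(k))/#{j′ : e_{j′} = k}`; `pointAugmentFat F F̃ e` = `F̃` then `[k = e_j ∧ Σ_ωF_ω(k) ≠ 1]`;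
  `sum_pointAugment` (`Σ_ωF⁺_ω = Σ_ωF_ω + [k ∈ range e]·(1 − Σ_ωF_ω)`), `…_eq_one_of_exists` / `…_eq_one_of_eq_one` (new plateau ⊇ points ∪ old plateau),
  `pointAugmentFat_mul_pointAugment` (`F̃⁺F⁺ = F⁺`), `pointAugment_eq_zero_of_sum_eq_zero`, `norm_pointAugment(Fat)_le_one`, multiplicity `ρ₁ + q`, overlap
  `ρ₀ + ρ₁ + q`;
* §2 for a line `C` whose nonzero entries have both legs in the OLD plateau (hĊ/hD of p544244): the pull-back by `S(F̃⁺)` is the old one on old legs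
  (`pullback_pointAugmentFat_augLeg`) and VANISHES on point legs, so row sums / column sums / entries transfer with the same `α`, `δ`; for a symbol
  supported in the old plateau the Gram half-norms transfer with the same `κ` (`norm_sectorGramF/G_pointAugmentFat_le`).
Downstream only the vertex level norms change (read w.r.t. `F⁺`: MIXED prescriptions).  Pure bookkeeping; definitions with bodies (`pointAugment`,
`pointAugmentFat`, `augLeg`, `augLegEmb`); no named facts; nothing asserts superconductivity.
-/

noncomputable section

namespace Summit.HubbardSuperconductivity.HubbardSuperconductivity.Theorems.KLRegimeSplit

set_option linter.dupNamespace false -- summit = problem name (single-conjunct summit), D-0017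

open Real Finset Literature.MathematicalPhysics.QuantumLattice Literature.Probability.LatticeModels Matrix

/-! ## §1 The augmented pair and its family axioms -/

section Family

variable {L M N q : ℕ}

/-- **The point-augmented THIN family**: `F` followed by `q` point multipliers `P_j(k) = [k = e_j]·(1 − Σ_ω F_ω(k))/#{j′ : e_{j′} = k}` —
so that `Σ_ω F⁺_ω = 1` at every `e_j` and wherever `Σ_ω F_ω = 1`. -/
def pointAugment (F : Fin N → FreqMomentum L M → ℂ) (e : Fin q → FreqMomentum L M) : Fin (N + q) → FreqMomentum L M → ℂ :=
  Fin.append F fun j k => if e j = k then (1 - ∑ ω, F ω k) / ((univ.filter fun j' : Fin q => e j' = k).card : ℂ) else 0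

/-- **The point-augmented FAT family**: `F̃` followed by the indicators `P̃_j(k) = [k = e_j ∧ Σ_ω F_ω(k) ≠ 1]` (`P̃_j·P_j = P_j`; `P̃_j` vanishes
on the plateau of `F`, hence on every line supported there). -/
def pointAugmentFat (F Ft : Fin N → FreqMomentum L M → ℂ) (e : Fin q → FreqMomentum L M) : Fin (N + q) → FreqMomentum L M → ℂ :=
  Fin.append Ft fun j k => if e j = k ∧ ∑ ω, F ω k ≠ 1 then 1 else 0

variable (F Ft : Fin N → FreqMomentum L M → ℂ) (e : Fin q → FreqMomentum L M)

/-- Old indices read the old thin family. -/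
@[simp] theorem pointAugment_castAdd (ω : Fin N) (k : FreqMomentum L M) : pointAugment F e (Fin.castAdd q ω) k = F ω k := by
  unfold pointAugment; rw [Fin.append_left]

/-- New indices read the point multipliers. -/
theorem pointAugment_natAdd (j : Fin q) (k : FreqMomentum L M) : pointAugment F e (Fin.natAdd N j) k =
    if e j = k then (1 - ∑ ω, F ω k) / ((univ.filter fun j' : Fin q => e j' = k).card : ℂ) else 0 := by
  unfold pointAugment; rw [Fin.append_right]

/-- Old indices read the old fat family. -/
@[simp] theorem pointAugmentFat_castAdd (ω : Fin N) (k : FreqMomentum L M) : pointAugmentFat F Ft e (Fin.castAdd q ω) k = Ft ω k := by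
  unfold pointAugmentFat; rw [Fin.append_left]

/-- New indices read the fat point indicators. -/
theorem pointAugmentFat_natAdd (j : Fin q) (k : FreqMomentum L M) :
    pointAugmentFat F Ft e (Fin.natAdd N j) k = if e j = k ∧ ∑ ω, F ω k ≠ 1 then 1 else 0 := by
  unfold pointAugmentFat; rw [Fin.append_right]

/-- **The plateau function of the augmented family**: `Σ_ω F⁺_ω(k) = Σ_ω F_ω(k) + [k ∈ range e]·(1 − Σ_ω F_ω(k))`. -/
theorem sum_pointAugment (k : FreqMomentum L M) :
    ∑ ω, pointAugment F e ω k = ∑ ω, F ω k + if ∃ j, e j = k then 1 - ∑ ω, F ω k else 0 := by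
  rw [Fin.sum_univ_add]
  simp only [pointAugment_castAdd, pointAugment_natAdd]
  congr 1
  rw [← sum_filter]
  by_cases h : ∃ j, e j = k
  · rw [if_pos h, sum_const, nsmul_eq_mul, mul_div_cancel₀]
    obtain ⟨j, hj⟩ := h
    exact_mod_cast (card_pos.2 ⟨j, mem_filter.2 ⟨mem_univ _, hj⟩⟩).ne'
  · rw [if_neg h, sum_eq_zero]
    intro j hj
    exact absurd ⟨j, (mem_filter.1 hj).2⟩ h

/-- `Σ_ω F⁺_ω(e_j) = 1`: the external momenta lie in the plateau of the augmented family. -/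
theorem sum_pointAugment_eq_one_of_exists {k : FreqMomentum L M} (h : ∃ j, e j = k) : ∑ ω, pointAugment F e ω k = 1 := by
  rw [sum_pointAugment, if_pos h]; ring

/-- The old plateau is kept: `Σ_ω F_ω(k) = 1 ⇒ Σ_ω F⁺_ω(k) = 1`. -/
theorem sum_pointAugment_eq_one_of_eq_one {k : FreqMomentum L M} (h : ∑ ω, F ω k = 1) : ∑ ω, pointAugment F e ω k = 1 := by
  rw [sum_pointAugment, h, sub_self]; split_ifs <;> ring

/-- **`F̃⁺·F⁺ = F⁺`** (from `F̃·F = F`). -/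
theorem pointAugmentFat_mul_pointAugment (hFF : ∀ ω k, Ft ω k * F ω k = F ω k) (ω : Fin (N + q)) (k : FreqMomentum L M) :
    pointAugmentFat F Ft e ω k * pointAugment F e ω k = pointAugment F e ω k := by
  induction ω using Fin.addCases with
  | left ω => rw [pointAugment_castAdd, pointAugmentFat_castAdd, hFF]
  | right j =>
    rw [pointAugment_natAdd, pointAugmentFat_natAdd]
    by_cases hj : e j = k
    · by_cases h1 : ∑ ω, F ω k = 1
      · rw [h1, sub_self, zero_div, if_pos hj, mul_zero]
      · rw [if_pos ⟨hj, h1⟩, one_mul]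
    · rw [if_neg hj, mul_zero]

/-- **`Σ_ω F⁺_ω(k) = 0 ⇒ F⁺_ω(k) = 0`** (from the same for `F`). -/
theorem pointAugment_eq_zero_of_sum_eq_zero (hF0 : ∀ k, ∑ ω, F ω k = 0 → ∀ ω, F ω k = 0) (k : FreqMomentum L M)
    (h : ∑ ω, pointAugment F e ω k = 0) (ω : Fin (N + q)) : pointAugment F e ω k = 0 := by
  rw [sum_pointAugment] at h
  have hne : ¬ ∃ j, e j = k := by
    intro hex
    rw [if_pos hex] at h
    norm_num at h
  rw [if_neg hne, add_zero] at h
  induction ω using Fin.addCases with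
  | left ω => rw [pointAugment_castAdd, hF0 k h]
  | right j => rw [pointAugment_natAdd, if_neg (fun hj => hne ⟨j, hj⟩)]

/-- `‖F⁺_ω(k)‖ ≤ 1` if `‖F_ω(k)‖ ≤ 1` and `‖1 − Σ_ω F_ω(k)‖ ≤ 1`. -/
theorem norm_pointAugment_le_one (hF : ∀ ω k, ‖F ω k‖ ≤ 1) (hR : ∀ k, ‖1 - ∑ ω, F ω k‖ ≤ 1) (ω : Fin (N + q)) (k : FreqMomentum L M) :
    ‖pointAugment F e ω k‖ ≤ 1 := by
  induction ω using Fin.addCases with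
  | left ω => rw [pointAugment_castAdd]; exact hF ω k
  | right j =>
    rw [pointAugment_natAdd]
    split_ifs with hj
    · have hc : (1 : ℝ) ≤ ((univ.filter fun j' : Fin q => e j' = k).card : ℝ) := by
        exact_mod_cast card_pos.2 ⟨j, mem_filter.2 ⟨mem_univ _, hj⟩⟩
      rw [norm_div, Complex.norm_natCast]
      exact (div_le_one (by linarith)).2 ((hR k).trans hc)
    · rw [norm_zero]; exact zero_le_one

/-- `‖F̃⁺_ω(k)‖ ≤ 1` if `‖F̃_ω(k)‖ ≤ 1`. -/
theorem norm_pointAugmentFat_le_one (hFt : ∀ ω k, ‖Ft ω k‖ ≤ 1) (ω : Fin (N + q)) (k : FreqMomentum L M) :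
    ‖pointAugmentFat F Ft e ω k‖ ≤ 1 := by
  induction ω using Fin.addCases with
  | left ω => rw [pointAugmentFat_castAdd]; exact hFt ω k
  | right j => rw [pointAugmentFat_natAdd]; split_ifs <;> simp

/-- The fat point indicator is supported at its momentum, OFF the old plateau. -/
theorem pointAugmentFat_natAdd_ne_zero {j : Fin q} {k : FreqMomentum L M} (h : pointAugmentFat F Ft e (Fin.natAdd N j) k ≠ 0) :
    e j = k ∧ ∑ ω, F ω k ≠ 1 := by
  rw [pointAugmentFat_natAdd] at h
  by_contra hc
  exact h (if_neg hc)

/-- Every index of `Fin (N + q)` is an old sector or a point. -/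
theorem mem_map_castAdd_or_natAdd (ω : Fin (N + q)) :
    ω ∈ (univ : Finset (Fin N)).map (Fin.castAddEmb q) ∨ ω ∈ (univ : Finset (Fin q)).map (Fin.natAddEmb N) := by
  induction ω using Fin.addCases with
  | left ω => exact Or.inl (mem_map.2 ⟨ω, mem_univ _, rfl⟩)
  | right j => exact Or.inr (mem_map.2 ⟨j, mem_univ _, rfl⟩)

/-- **Multiplicity**: at most `ρ₁ + q` augmented fat multipliers meet any momentum (from `ρ₁` for `F̃`). -/
theorem card_filter_pointAugmentFat_ne_zero_le {ρ₁ : ℕ} (hρ₁ : ∀ k : FreqMomentum L M, ((univ : Finset (Fin N)).filter fun ω => Ft ω k ≠ 0).card ≤ ρ₁)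
    (k : FreqMomentum L M) : ((univ : Finset (Fin (N + q))).filter fun ω => pointAugmentFat F Ft e ω k ≠ 0).card ≤ ρ₁ + q := by
  classical
  calc ((univ : Finset (Fin (N + q))).filter fun ω => pointAugmentFat F Ft e ω k ≠ 0).card
      ≤ ((((univ : Finset (Fin N)).filter fun ω => Ft ω k ≠ 0).map (Fin.castAddEmb q)) ∪ (univ : Finset (Fin q)).map (Fin.natAddEmb N)).card := by
        refine card_le_card fun ω hω => ?_
        have hω' := (mem_filter.1 hω).2
        rcases mem_map_castAdd_or_natAdd (N := N) (q := q) ω with h | h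
        · obtain ⟨ω₀, -, rfl⟩ := mem_map.1 h
          refine mem_union_left _ (mem_map.2 ⟨ω₀, mem_filter.2 ⟨mem_univ _, ?_⟩, rfl⟩)
          simpa only [Fin.castAddEmb_apply, pointAugmentFat_castAdd] using hω'
        · exact mem_union_right _ h
    _ ≤ ρ₁ + q := (card_union_le _ _).trans (Nat.add_le_add (by rw [card_map]; exact hρ₁ k) (by rw [card_map, card_univ, Fintype.card_fin]))

variable [NeZero L]

/-- **Overlap**: every augmented fat multiplier meets at most `ρ₀ + ρ₁ + q` others (old overlap `ρ₀`, old multiplicity `ρ₁`). -/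
theorem card_filter_overlap_pointAugmentFat_le {ρ₀ ρ₁ : ℕ}
    (hρ₀ : ∀ ω : Fin N, ((univ : Finset (Fin N)).filter fun ω' => ∃ k, Ft ω k * Ft ω' k ≠ 0).card ≤ ρ₀)
    (hρ₁ : ∀ k : FreqMomentum L M, ((univ : Finset (Fin N)).filter fun ω => Ft ω k ≠ 0).card ≤ ρ₁) (ω : Fin (N + q)) :
    ((univ : Finset (Fin (N + q))).filter fun ω' => ∃ k, pointAugmentFat F Ft e ω k * pointAugmentFat F Ft e ω' k ≠ 0).card ≤ ρ₀ + ρ₁ + q := by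
  classical
  induction ω using Fin.addCases with
  | left ω₀ =>
    calc ((univ : Finset (Fin (N + q))).filter fun ω' => ∃ k, pointAugmentFat F Ft e (Fin.castAdd q ω₀) k * pointAugmentFat F Ft e ω' k ≠ 0).card
        ≤ ((((univ : Finset (Fin N)).filter fun ω' => ∃ k, Ft ω₀ k * Ft ω' k ≠ 0).map (Fin.castAddEmb q)) ∪
            (univ : Finset (Fin q)).map (Fin.natAddEmb N)).card := by
          refine card_le_card fun ω hω => ?_
          obtain ⟨k, hk⟩ := (mem_filter.1 hω).2
          rcases mem_map_castAdd_or_natAdd (N := N) (q := q) ω with h | h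
          · obtain ⟨ω₁, -, rfl⟩ := mem_map.1 h
            refine mem_union_left _ (mem_map.2 ⟨ω₁, mem_filter.2 ⟨mem_univ _, ⟨k, ?_⟩⟩, rfl⟩)
            simpa only [Fin.castAddEmb_apply, pointAugmentFat_castAdd] using hk
          · exact mem_union_right _ h
      _ ≤ ρ₀ + q := (card_union_le _ _).trans (Nat.add_le_add (by rw [card_map]; exact hρ₀ ω₀) (by rw [card_map, card_univ, Fintype.card_fin]))
      _ ≤ ρ₀ + ρ₁ + q := by omega
  | right j =>
    calc ((univ : Finset (Fin (N + q))).filter fun ω' => ∃ k, pointAugmentFat F Ft e (Fin.natAdd N j) k * pointAugmentFat F Ft e ω' k ≠ 0).card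
        ≤ ((univ : Finset (Fin (N + q))).filter fun ω' => pointAugmentFat F Ft e ω' (e j) ≠ 0).card := by
          refine card_le_card fun ω hω => mem_filter.2 ⟨mem_univ _, ?_⟩
          obtain ⟨k, hk⟩ := (mem_filter.1 hω).2
          have h1 : pointAugmentFat F Ft e (Fin.natAdd N j) k ≠ 0 := left_ne_zero_of_mul hk
          rw [(pointAugmentFat_natAdd_ne_zero F Ft e h1).1]
          exact right_ne_zero_of_mul hk
      _ ≤ ρ₁ + q := card_filter_pointAugmentFat_ne_zero_le F Ft e hρ₁ (e j)
      _ ≤ ρ₀ + ρ₁ + q := by omega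

end Family

/-! ## §2 The pulled-back lines and the Gram data do not see the points (lines supported in the old plateau) -/

section Lines

variable {L M N q : ℕ} [NeZero L] (β : ℝ) (F Ft : Fin N → FreqMomentum L M → ℂ) (e : Fin q → FreqMomentum L M)

/-- The old sector legs inside the augmented ones. -/
def augLeg (Y : SpaceTimeIdx L M × SectorLeg N) : SpaceTimeIdx L M × SectorLeg (N + q) := (Y.1, ((Fin.castAdd q Y.2.1.1, Y.2.1.2), Y.2.2))

omit [NeZero L] in
/-- `augLeg` is injective. -/
theorem augLeg_injective : Function.Injective (augLeg (L := L) (M := M) (N := N) (q := q)) := by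
  rintro ⟨ξ, ⟨⟨ω, σ⟩, c⟩⟩ ⟨ξ', ⟨⟨ω', σ'⟩, c'⟩⟩ h
  simp only [augLeg, Prod.mk.injEq] at h
  obtain ⟨rfl, ⟨hω, rfl⟩, rfl⟩ := h
  rw [Fin.castAdd_inj.1 hω]

/-- The old sector legs as an embedding. -/
def augLegEmb : (SpaceTimeIdx L M × SectorLeg N) ↪ (SpaceTimeIdx L M × SectorLeg (N + q)) := ⟨augLeg, augLeg_injective⟩

omit [NeZero L] in
/-- Unfolding `augLegEmb`. -/
@[simp] theorem augLegEmb_apply (Y : SpaceTimeIdx L M × SectorLeg N) : augLegEmb (q := q) Y = augLeg Y := rfl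

omit [NeZero L] in
/-- On old sector legs the augmented substitution matrix is the old one. -/
theorem sectorSubMatrix_pointAugmentFat_augLeg (K : HubbardFieldIdx L M) (Y : SpaceTimeIdx L M × SectorLeg N) :
    sectorSubMatrix L M β (pointAugmentFat F Ft e) K (augLeg Y) = sectorSubMatrix L M β Ft K Y := by
  simp only [sectorSubMatrix_apply, augLeg, pointAugmentFat_castAdd]

omit [NeZero L] in
/-- On a point leg the augmented substitution matrix vanishes at every momentum of the old plateau. -/
theorem sectorSubMatrix_pointAugmentFat_natAdd_eq_zero (K : HubbardFieldIdx L M) (hK : ∑ ω, F ω K.1.1 = 1) (ξ : SpaceTimeIdx L M) (j : Fin q)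
    (σ c : Fin 2) : sectorSubMatrix L M β (pointAugmentFat F Ft e) K (ξ, ((Fin.natAdd N j, σ), c)) = 0 := by
  rw [sectorSubMatrix_apply]
  split_ifs with h
  · rw [pointAugmentFat_natAdd, if_neg (fun h' => h'.2 hK), zero_mul, mul_zero]
  · rfl

/-- A leg of `SectorLeg (N + q)` off the image of `augLeg` is a point leg. -/
theorem exists_natAdd_of_not_mem_map (Y : SpaceTimeIdx L M × SectorLeg (N + q)) (hY : Y ∉ (univ : Finset _).map (augLegEmb (N := N))) :
    ∃ j : Fin q, Y.2.1.1 = Fin.natAdd N j := by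
  obtain ⟨ξ, ⟨⟨ω, σ⟩, c⟩⟩ := Y
  induction ω using Fin.addCases with
  | left ω => exact absurd (mem_map.2 ⟨(ξ, ((ω, σ), c)), mem_univ _, rfl⟩) hY
  | right j => exact ⟨j, rfl⟩

variable (C : Matrix (HubbardFieldIdx L M) (HubbardFieldIdx L M) ℂ)
  (hC : ∀ K K', C K K' ≠ 0 → ∑ ω, F ω K.1.1 = 1 ∧ ∑ ω, F ω K'.1.1 = 1)

/-- **Old × old entries of the augmented pull-back are the old entries.** -/
theorem pullback_pointAugmentFat_augLeg (Y Y' : SpaceTimeIdx L M × SectorLeg N) :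
    ((sectorSubMatrix L M β (pointAugmentFat F Ft e)).transpose * C * sectorSubMatrix L M β (pointAugmentFat F Ft e)) (augLeg Y) (augLeg Y') =
      ((sectorSubMatrix L M β Ft).transpose * C * sectorSubMatrix L M β Ft) Y Y' := by
  simp only [Matrix.mul_apply, Matrix.transpose_apply, sectorSubMatrix_pointAugmentFat_augLeg]

include hC in
/-- **Entries of the augmented pull-back with a point ROW leg vanish** (the line lives in the old plateau, where the fat points vanish). -/
theorem pullback_pointAugmentFat_eq_zero_left (Y Y' : SpaceTimeIdx L M × SectorLeg (N + q)) (j : Fin q) (hY : Y.2.1.1 = Fin.natAdd N j) :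
    ((sectorSubMatrix L M β (pointAugmentFat F Ft e)).transpose * C * sectorSubMatrix L M β (pointAugmentFat F Ft e)) Y Y' = 0 := by
  obtain ⟨ξ, ⟨⟨ω, σ⟩, c⟩⟩ := Y
  simp only at hY
  subst hY
  simp only [Matrix.mul_apply, Matrix.transpose_apply]
  refine sum_eq_zero fun K' _ => ?_
  rw [sum_eq_zero fun K _ => ?_, zero_mul]
  by_cases h : C K K' = 0
  · rw [h, mul_zero]
  · rw [sectorSubMatrix_pointAugmentFat_natAdd_eq_zero β F Ft e K (hC K K' h).1, zero_mul]

include hC in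
/-- **Entries of the augmented pull-back with a point COLUMN leg vanish.** -/
theorem pullback_pointAugmentFat_eq_zero_right (Y Y' : SpaceTimeIdx L M × SectorLeg (N + q)) (j : Fin q) (hY' : Y'.2.1.1 = Fin.natAdd N j) :
    ((sectorSubMatrix L M β (pointAugmentFat F Ft e)).transpose * C * sectorSubMatrix L M β (pointAugmentFat F Ft e)) Y Y' = 0 := by
  obtain ⟨ξ, ⟨⟨ω, σ⟩, c⟩⟩ := Y'
  simp only at hY'
  subst hY'
  simp only [Matrix.mul_apply, Matrix.transpose_apply]
  refine sum_eq_zero fun K' _ => ?_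
  by_cases h0 : ∑ K, sectorSubMatrix L M β (pointAugmentFat F Ft e) K Y * C K K' = 0
  · rw [h0, zero_mul]
  · obtain ⟨K, -, hK⟩ := exists_ne_zero_of_sum_ne_zero h0
    rw [sectorSubMatrix_pointAugmentFat_natAdd_eq_zero β F Ft e K' (hC K K' (right_ne_zero_of_mul hK)).2, mul_zero]

/-- Sums over the augmented legs of a function vanishing on point legs reduce to sums over the old legs. -/
theorem sum_augLeg_eq (f : SpaceTimeIdx L M × SectorLeg (N + q) → ℝ) (hf : ∀ Y, ∀ j : Fin q, Y.2.1.1 = Fin.natAdd N j → f Y = 0) :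
    ∑ Y, f Y = ∑ Y : SpaceTimeIdx L M × SectorLeg N, f (augLeg Y) := by
  classical
  rw [← sum_subset (subset_univ ((univ : Finset (SpaceTimeIdx L M × SectorLeg N)).map (augLegEmb (q := q)))) fun Y _ hY => ?_, sum_map]
  · rfl
  · obtain ⟨j, hj⟩ := exists_natAdd_of_not_mem_map Y hY
    exact hf Y j hj

include hC in
/-- **Row sums transfer** (`hrow` for `F̃⁺` from `hrow` for `F̃`). -/
theorem rowSum_pullback_pointAugmentFat_le {α : ℝ} (hα : 0 ≤ α)
    (hrow : ∀ X, ∑ Y, ‖((sectorSubMatrix L M β Ft).transpose * C * sectorSubMatrix L M β Ft) X Y‖ ≤ α) (X : SpaceTimeIdx L M × SectorLeg (N + q)) :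
    ∑ Y, ‖((sectorSubMatrix L M β (pointAugmentFat F Ft e)).transpose * C * sectorSubMatrix L M β (pointAugmentFat F Ft e)) X Y‖ ≤ α := by
  rw [sum_augLeg_eq _ fun Y j hj => by rw [pullback_pointAugmentFat_eq_zero_right β F Ft e C hC X Y j hj, norm_zero]]
  by_cases hX : X ∈ (univ : Finset _).map (augLegEmb (N := N) (q := q))
  · obtain ⟨X₀, -, rfl⟩ := mem_map.1 hX
    simp only [augLegEmb_apply, pullback_pointAugmentFat_augLeg β F Ft e C]
    exact hrow X₀
  · obtain ⟨j, hj⟩ := exists_natAdd_of_not_mem_map X hX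
    simp only [pullback_pointAugmentFat_eq_zero_left β F Ft e C hC X _ j hj, norm_zero, sum_const_zero]
    exact hα

include hC in
/-- **Column sums transfer.** -/
theorem colSum_pullback_pointAugmentFat_le {α : ℝ} (hα : 0 ≤ α)
    (hcol : ∀ Y, ∑ X, ‖((sectorSubMatrix L M β Ft).transpose * C * sectorSubMatrix L M β Ft) X Y‖ ≤ α) (Y : SpaceTimeIdx L M × SectorLeg (N + q)) :
    ∑ X, ‖((sectorSubMatrix L M β (pointAugmentFat F Ft e)).transpose * C * sectorSubMatrix L M β (pointAugmentFat F Ft e)) X Y‖ ≤ α := by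
  rw [sum_augLeg_eq _ fun X j hj => by rw [pullback_pointAugmentFat_eq_zero_left β F Ft e C hC X Y j hj, norm_zero]]
  by_cases hY : Y ∈ (univ : Finset _).map (augLegEmb (N := N) (q := q))
  · obtain ⟨Y₀, -, rfl⟩ := mem_map.1 hY
    simp only [augLegEmb_apply, pullback_pointAugmentFat_augLeg β F Ft e C]
    exact hcol Y₀
  · obtain ⟨j, hj⟩ := exists_natAdd_of_not_mem_map Y hY
    simp only [pullback_pointAugmentFat_eq_zero_right β F Ft e C hC _ Y j hj, norm_zero, sum_const_zero]
    exact hα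

include hC in
/-- **Entries transfer.** -/
theorem entry_pullback_pointAugmentFat_le {δ : ℝ} (hδ : 0 ≤ δ)
    (hent : ∀ X Y, ‖((sectorSubMatrix L M β Ft).transpose * C * sectorSubMatrix L M β Ft) X Y‖ ≤ δ) (X Y : SpaceTimeIdx L M × SectorLeg (N + q)) :
    ‖((sectorSubMatrix L M β (pointAugmentFat F Ft e)).transpose * C * sectorSubMatrix L M β (pointAugmentFat F Ft e)) X Y‖ ≤ δ := by
  classical
  by_cases hX : X ∈ (univ : Finset _).map (augLegEmb (N := N) (q := q))
  · by_cases hY : Y ∈ (univ : Finset _).map (augLegEmb (N := N) (q := q))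
    · obtain ⟨X₀, -, rfl⟩ := mem_map.1 hX
      obtain ⟨Y₀, -, rfl⟩ := mem_map.1 hY
      rw [augLegEmb_apply, augLegEmb_apply, pullback_pointAugmentFat_augLeg β F Ft e C]
      exact hent X₀ Y₀
    · obtain ⟨j, hj⟩ := exists_natAdd_of_not_mem_map Y hY
      rw [pullback_pointAugmentFat_eq_zero_right β F Ft e C hC X Y j hj, norm_zero]
      exact hδ
  · obtain ⟨j, hj⟩ := exists_natAdd_of_not_mem_map X hX
    rw [pullback_pointAugmentFat_eq_zero_left β F Ft e C hC X Y j hj, norm_zero]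
    exact hδ

/-- **Gram data transfer, charge-`0` legs**: for a symbol supported in the old plateau, `‖sectorGramF … F̃⁺ p Y‖ ≤ κ` from the same for `F̃`. -/
theorem norm_sectorGramF_pointAugmentFat_le (p : FreqMomentum L M × Fin 2 → ℂ) (hp : ∀ ks, p ks ≠ 0 → ∑ ω, F ω ks.1 = 1) {κ : ℝ} (hκ : 0 ≤ κ)
    (h : ∀ Y : SpaceTimeIdx L M × SectorLeg N, Y.2.2 = 0 → ‖sectorGramF L M β Ft p Y‖ ≤ κ) (Y : SpaceTimeIdx L M × SectorLeg (N + q))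
    (hY : Y.2.2 = 0) : ‖sectorGramF L M β (pointAugmentFat F Ft e) p Y‖ ≤ κ := by
  obtain ⟨ξ, ⟨⟨ω, σ⟩, c⟩⟩ := Y
  induction ω using Fin.addCases with
  | left ω =>
    have he : ‖sectorGramF L M β (pointAugmentFat F Ft e) p (ξ, ((Fin.castAdd q ω, σ), c))‖ = ‖sectorGramF L M β Ft p (ξ, ((ω, σ), c))‖ := by
      refine (pow_left_inj₀ (norm_nonneg _) (norm_nonneg _) two_ne_zero).1 ?_
      rw [norm_sq_sectorGramF, norm_sq_sectorGramF]
      simp only [pointAugmentFat_castAdd]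
    rw [he]; exact h _ hY
  | right j =>
    have h0 : ‖sectorGramF L M β (pointAugmentFat F Ft e) p (ξ, ((Fin.natAdd N j, σ), c))‖ ^ 2 = 0 := by
      rw [norm_sq_sectorGramF]
      refine sum_eq_zero fun k _ => ?_
      by_cases hk : pointAugmentFat F Ft e (Fin.natAdd N j) k = 0
      · simp only [hk, norm_zero, zero_pow two_ne_zero, mul_zero, zero_mul]
      · have hpk : p (k, σ) = 0 := by
          by_contra hne
          exact (pointAugmentFat_natAdd_ne_zero F Ft e hk).2 (hp (k, σ) hne)
        simp only [hpk, norm_zero, mul_zero]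
    rw [pow_eq_zero_iff two_ne_zero] at h0
    rw [h0]; exact hκ

/-- **Gram data transfer, charge-`1` legs.** -/
theorem norm_sectorGramG_pointAugmentFat_le (p : FreqMomentum L M × Fin 2 → ℂ) (hp : ∀ ks, p ks ≠ 0 → ∑ ω, F ω ks.1 = 1) {κ : ℝ} (hκ : 0 ≤ κ)
    (h : ∀ Y : SpaceTimeIdx L M × SectorLeg N, Y.2.2 = 1 → ‖sectorGramG L M β Ft p Y‖ ≤ κ) (Y : SpaceTimeIdx L M × SectorLeg (N + q))
    (hY : Y.2.2 = 1) : ‖sectorGramG L M β (pointAugmentFat F Ft e) p Y‖ ≤ κ := by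
  obtain ⟨ξ, ⟨⟨ω, σ⟩, c⟩⟩ := Y
  induction ω using Fin.addCases with
  | left ω =>
    have he : ‖sectorGramG L M β (pointAugmentFat F Ft e) p (ξ, ((Fin.castAdd q ω, σ), c))‖ = ‖sectorGramG L M β Ft p (ξ, ((ω, σ), c))‖ := by
      refine (pow_left_inj₀ (norm_nonneg _) (norm_nonneg _) two_ne_zero).1 ?_
      rw [norm_sq_sectorGramG, norm_sq_sectorGramG]
      simp only [pointAugmentFat_castAdd]
    rw [he]; exact h _ hY
  | right j =>
    have h0 : ‖sectorGramG L M β (pointAugmentFat F Ft e) p (ξ, ((Fin.natAdd N j, σ), c))‖ ^ 2 = 0 := by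
      rw [norm_sq_sectorGramG]
      refine sum_eq_zero fun k _ => ?_
      by_cases hk : pointAugmentFat F Ft e (Fin.natAdd N j) k = 0
      · simp only [hk, norm_zero, zero_pow two_ne_zero, mul_zero, zero_mul]
      · have hpk : p (k, σ) = 0 := by
          by_contra hne
          exact (pointAugmentFat_natAdd_ne_zero F Ft e hk).2 (hp (k, σ) hne)
        simp only [hpk, norm_zero, mul_zero]
    rw [pow_eq_zero_iff two_ne_zero] at h0
    rw [h0]; exact hκ

end Lines

end Summit.HubbardSuperconductivity.HubbardSuperconductivity.Theorems.KLRegimeSplit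

end
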